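import Literature.AnabelianGeometry.SemiGraphs.SubgroupPresentationArithCompat
import HarnessLib

/-!
# Arithmetic compatibility from the conjugation form of [SemiAnbd] Prop 3.6 (iv) / Def 5.1 (i)

Mochizuki, *Semi-graphs of anabelioids*, Publ. RIMS **42** (2006), Prop. 3.6 (iv) p. 39 (a morphism of
semi-graphs of anabelioids carries verticial / edge-like subgroups onto conjugates of verticial / edge-like
subgroups) and Def. 5.1 (i) p. 62 (the arithmetic action `ρ` acts through automorphisms of `𝒢`)
[cite: MochizukiSemiAnbd2006, Prop 3.6 (iv), p. 39].

PURE GROUP THEORY (cell row T54-B, tower third, file T4c; plan/GAP-LEDGER.md G-w4d053-1, binder `hP`).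
The hypotheses `exists_isVConj` / `exists_isEConj` (clause 1) of `IsArithCompatible`
(`SubgroupPresentationArithCompat.lean`) are stated ELEMENTWISE; the cell's dictionaries (abc-iut-w4-d082's
`map_mem_verticialSubgroups_of_chartPullback_iso` / `…edgeLikeSubgroups…`, abc-iut-w4-d059's
`exists_conj`) produce them in CONJUGATION FORM `Φ_e(H_w) = k H_{σ_e w} k⁻¹`,
`Φ_e(M_ε) ≤ m M_{σ_e ε} m⁻¹`.  This file converts: `isVConj_of_map_eq`, `isVConj_iff_map_eq`,
`mem_map_of_map_le`, and the constructor `IsArithCompatible.of_conj`.  Nothing here bears on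
[IUTchIII] Cor. 3.12.
-/

namespace Literature.AnabelianGeometry.SemiGraphs

namespace SemiGraph

namespace SubgroupPresentation

open CategoryTheory

universe u v

variable {𝔾 : SemiGraph.{u}} {Γ : Type u} [Group Γ] {E : Type v} [Group E]
  (P : SubgroupPresentation 𝔾 Γ) {Φ : E →* MulAut Γ} {σ : E →* Aut 𝔾}

/-- **A conjugation-form vertex compatibility gives a vertex conjugator**: if `Φ_e(H_w) = k H_{σ_e w} k⁻¹`
then `k` is a vertex conjugator for `e` at `w`. [cite: MochizukiSemiAnbd2006, Prop 3.6 (iv), p. 39] -/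
theorem isVConj_of_map_eq {e : E} {w : 𝔾.Vertex} {k : Γ}
    (h : (P.H w).map (Φ e).toMonoidHom = (P.H ((σ e).hom.vertexMap w)).map (MulAut.conj k).toMonoidHom) :
    P.IsVConj Φ σ e w k := by
  intro x
  constructor
  · intro hx
    have hx' : Φ e x ∈ (P.H ((σ e).hom.vertexMap w)).map (MulAut.conj k).toMonoidHom :=
      h ▸ ⟨x, hx, rfl⟩
    obtain ⟨y, hy, hyx⟩ := hx'
    simp only [MulEquiv.coe_toMonoidHom, MulAut.conj_apply] at hyx
    have : k⁻¹ * Φ e x * k = y := by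
      rw [← hyx]
      group
    rw [this]
    exact hy
  · intro hx
    have hx' : Φ e x ∈ (P.H w).map (Φ e).toMonoidHom := by
      rw [h]
      refine ⟨k⁻¹ * Φ e x * k, hx, ?_⟩
      simp only [MulEquiv.coe_toMonoidHom, MulAut.conj_apply]
      group
    obtain ⟨y, hy, hyx⟩ := hx'
    have : y = x := (Φ e).injective (by simpa only [MulEquiv.coe_toMonoidHom] using hyx)
    exact this ▸ hy

/-- Conversely a vertex conjugator gives the conjugation form. [cite: MochizukiSemiAnbd2006, Prop 3.6 (iv), p. 39] -/
theorem map_eq_of_isVConj {e : E} {w : 𝔾.Vertex} {k : Γ} (hk : P.IsVConj Φ σ e w k) :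
    (P.H w).map (Φ e).toMonoidHom = (P.H ((σ e).hom.vertexMap w)).map (MulAut.conj k).toMonoidHom := by
  ext z
  constructor
  · rintro ⟨x, hx, rfl⟩
    refine ⟨k⁻¹ * Φ e x * k, (hk x).mp hx, ?_⟩
    simp only [MulEquiv.coe_toMonoidHom, MulAut.conj_apply]
    group
  · rintro ⟨y, hy, rfl⟩
    refine ⟨(Φ e).symm (k * y * k⁻¹), ?_, ?_⟩
    · refine (hk _).mpr ?_
      rw [MulEquiv.apply_symm_apply]
      have : k⁻¹ * (k * y * k⁻¹) * k = y := by group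
      rw [this]
      exact hy
    · simp only [MulEquiv.coe_toMonoidHom, MulAut.conj_apply, MulEquiv.apply_symm_apply]

/-- The two forms are equivalent. [cite: MochizukiSemiAnbd2006, Prop 3.6 (iv), p. 39] -/
theorem isVConj_iff_map_eq {e : E} {w : 𝔾.Vertex} {k : Γ} :
    P.IsVConj Φ σ e w k ↔
      (P.H w).map (Φ e).toMonoidHom = (P.H ((σ e).hom.vertexMap w)).map (MulAut.conj k).toMonoidHom :=
  ⟨P.map_eq_of_isVConj, P.isVConj_of_map_eq⟩

/-- **A conjugation-form edge compatibility gives clause 1 of an edge conjugator**: if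
`Φ_e(M_ε) ≤ m M_{σ_e ε} m⁻¹` then `m⁻¹ Φ_e(x) m ∈ M_{σ_e ε}` for `x ∈ M_ε`.
[cite: MochizukiSemiAnbd2006, Prop 3.6 (iv), p. 39] -/
theorem mem_of_map_le {e : E} {ε : 𝔾.Edge} {m : Γ}
    (h : (P.M ε).map (Φ e).toMonoidHom ≤ (P.M ((σ e).hom.edgeMap ε)).map (MulAut.conj m).toMonoidHom)
    (x : Γ) (hx : x ∈ P.M ε) : m⁻¹ * Φ e x * m ∈ P.M ((σ e).hom.edgeMap ε) := by
  obtain ⟨y, hy, hyx⟩ := h ⟨x, hx, rfl⟩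
  simp only [MulEquiv.coe_toMonoidHom, MulAut.conj_apply] at hyx
  have : m⁻¹ * Φ e x * m = y := by
    rw [← hyx]
    group
  rw [this]
  exact hy

/-- **Constructor of `IsArithCompatible` from conjugation-form data**: self-normalising vertex groups,
a graph, edge groups = meets of positioned vertex groups, `Φ_e(H_w) = k H_{σ_e w} k⁻¹` for some `k`,
and `Φ_e(M_ε) ≤ m M_{σ_e ε} m⁻¹` for some `m` satisfying the branch clause.
[cite: MochizukiSemiAnbd2006, Thm 5.4, p. 66] -/
theorem IsArithCompatible.of_conj
    (hself : ∀ (w : 𝔾.Vertex) (n : Γ), (∀ x : Γ, x ∈ P.H w ↔ n⁻¹ * x * n ∈ P.H w) → n ∈ P.H w)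
    (habuts : ∀ b : 𝔾.Branch, (𝔾.abuts b).isSome)
    (hedge : ∀ (b b' : 𝔾.Branch) (w w' : 𝔾.Vertex), b ≠ b' → 𝔾.edgeOf b = 𝔾.edgeOf b' →
      𝔾.abuts b = some w → 𝔾.abuts b' = some w' → ∀ x : Γ,
        x ∈ P.M (𝔾.edgeOf b) ↔ P.s b * x * (P.s b)⁻¹ ∈ P.H w ∧ P.s b' * x * (P.s b')⁻¹ ∈ P.H w')
    (hV : ∀ (e : E) (w : 𝔾.Vertex), ∃ k : Γ,
      (P.H w).map (Φ e).toMonoidHom = (P.H ((σ e).hom.vertexMap w)).map (MulAut.conj k).toMonoidHom)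
    (hE : ∀ (e : E) (ε : 𝔾.Edge), ∃ m : Γ,
      (P.M ε).map (Φ e).toMonoidHom ≤ (P.M ((σ e).hom.edgeMap ε)).map (MulAut.conj m).toMonoidHom ∧
        ∀ (b : 𝔾.Branch) (w : 𝔾.Vertex), 𝔾.edgeOf b = ε → 𝔾.abuts b = some w →
          ∃ k : Γ, (P.H w).map (Φ e).toMonoidHom =
              (P.H ((σ e).hom.vertexMap w)).map (MulAut.conj k).toMonoidHom ∧
            P.s ((σ e).hom.branchMap b) * m⁻¹ * (Φ e (P.s b))⁻¹ * k ∈ P.H ((σ e).hom.vertexMap w)) :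
    P.IsArithCompatible Φ σ where
  selfNormalizing := hself
  abuts_isSome := habuts
  edge_eq_inf := hedge
  exists_isVConj e w := by
    obtain ⟨k, hk⟩ := hV e w
    exact ⟨k, P.isVConj_of_map_eq hk⟩
  exists_isEConj e ε := by
    obtain ⟨m, hm, hbr⟩ := hE e ε
    refine ⟨m, P.mem_of_map_le hm, fun b w hb hw => ?_⟩
    obtain ⟨k, hk, hmem⟩ := hbr b w hb hw
    exact ⟨k, P.isVConj_of_map_eq hk, hmem⟩

end SubgroupPresentation

end SemiGraph

end Literature.AnabelianGeometry.SemiGraphs
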